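import Summits.AtomisticToContinuum.HydrodynamicLimit.Theorems.AntiMazurCoboundariesCorrectorPressureDecayKiferFreeMeanCount

/-!
# Mean particle number of a free box of arbitrary side and position (line `FirstLemma`, crux stmt-AtomisticToContinuum-14135)

Registered stub `c9_free_box_mean_count_sub_le` (lead seat c9; piece (B1') of the thermodynamic step of the Gibbs route of the
tangent entropy bound) and the shared definition `c9Box`, namespace
`Summit.AtomisticToContinuum.HydrodynamicLimit.Theorems.KiferCompactification`: for `0 < z ≤ 1/64`, `β > 0`, a
translation-invariant DLR state `G` of the unit-diameter hard-sphere gas at activity `z` (`IsHardSphereGibbs 1 z β u G`) and the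
FREE grand-canonical measure `γ_Λ(· | ∅) = gibbsSpecMeasure 1 z β u Λ ∅` on the closed box `Λ = c9Box a ℓ = ∏ᵢ [aᵢ, aᵢ + ℓ]` of
any side `ℓ ≥ 1` at any position `a`, the mean particle number is `density G · ℓ³ + O(ℓ²)`, uniformly in `a` and `ℓ`.

This is the general-box version of `c9_free_mean_count_sub_density_mul_volume_le` (`…KiferFreeMeanCount.lean`, the cubes
`Λ_n`), with the same proof: GNZ on both sides (`HardSphereDLR.lintegral_count_gibbsSpecMeasure_eq`,
`density_eq_activity_mul_measure_ball_empty`) reduces the claim to `z ∫_Λ |γ_Λ(·|∅){no centre in B(q,1)} - G{no centre in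
B(0,1)}| dq ≤ C ℓ²`; the integrand is `≤ C₀ 4^{-d}` at points `q` with `B(q, d+3) ⊆ Λ` (`freeMean_abs_real_vacant_sub_le`, valid
for every bounded measurable `Λ`) and `≤ 1` everywhere; layer cake over the inner boxes `Q_d = ∏ᵢ [aᵢ + d, aᵢ + ℓ - d]`
(`freeBox_setLIntegral_le`): the shells `Q_d \ Q_{d+1}` cover `Λ`, have volume `≤ 8 ℓ²`, and `∑_d 4^{-d} ≤ 2`.

References: D. Ruelle, *Statistical Mechanics: Rigorous Results* (1969) §4.2; M. Michelen, W. Perkins, arXiv:2109.01094, Thm 25;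
D. Dereudre, LNM 2237 (2019), Thm 2 and Prop. 10 (GNZ). One definition (`c9Box`), no named facts.
-/

noncomputable section

open MeasureTheory ProbabilityTheory Set Filter Topology
open scoped ENNReal NNReal

namespace Summit.AtomisticToContinuum.HydrodynamicLimit.Theorems.KiferCompactification

open Literature.MathematicalPhysics.KineticTheory (V3)
open Literature.MathematicalPhysics.KineticTheory.HardSphereDLR (gibbsSpecMeasure gibbsSpecMeasure_univ_le_one
  lintegral_count_gibbsSpecMeasure_eq lintegral_freeVolume_eq density_eq_activity_mul_measure_ball_empty)
open Literature.MathematicalPhysics.KineticTheory.PointProcess (density)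
open Literature.Analysis.FluidPDE (IsHardSphereGibbs IsTranslationInvariant)
open Literature.Analysis.FunctionSpaces (PointConfig)

/-- The closed axis-parallel BOX of side `ℓ` with lower corner `a`: `{y | ∀ i, y i ∈ [a i, a i + ℓ]}` (the cores `c9CellCore` of the cells
are such boxes: `c9CellCore S m j = c9Box (corner + 1) (S/m - 2)`). -/
def c9Box (a : V3) (ℓ : ℝ) : Set V3 :=
  {y | ∀ i, y i ∈ Icc (a i) (a i + ℓ)}

/-! ## Geometry of coordinate boxes -/

/-- Coordinate boxes `{y | ∀ i, yᵢ ∈ sᵢ}` over measurable `sᵢ ⊆ ℝ` are measurable. -/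
theorem freeBox_measurableSet_coordBox {s : Fin 3 → Set ℝ} (hs : ∀ i, MeasurableSet (s i)) :
    MeasurableSet {y : V3 | ∀ i, y i ∈ s i} := by
  have h : {y : V3 | ∀ i, y i ∈ s i} = ⋂ i, (fun y : V3 => y i) ⁻¹' s i := by ext y; simp
  rw [h]
  exact MeasurableSet.iInter fun i => (hs i).preimage (by fun_prop)

/-- **Volume of a coordinate box**: `|{y | ∀ i, yᵢ ∈ sᵢ}| = ∏ᵢ |sᵢ|` (Lebesgue measure on `ℝ³ = EuclideanSpace ℝ (Fin 3)` is the
image of the product measure under the measure-preserving `WithLp` equivalence). -/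
theorem freeBox_volume_coordBox {s : Fin 3 → Set ℝ} (hs : ∀ i, MeasurableSet (s i)) :
    volume {y : V3 | ∀ i, y i ∈ s i} = ∏ i, volume (s i) := by
  have h : {y : V3 | ∀ i, y i ∈ s i} = (WithLp.ofLp : V3 → Fin 3 → ℝ) ⁻¹' Set.pi univ s := by ext y; simp
  rw [h, (PiLp.volume_preserving_ofLp (Fin 3)).measure_preimage (MeasurableSet.univ_pi hs).nullMeasurableSet, volume_pi_pi]

/-- The box `c9Box a ℓ` is measurable. -/
theorem freeBox_measurableSet (a : V3) (ℓ : ℝ) : MeasurableSet (c9Box a ℓ) :=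
  freeBox_measurableSet_coordBox fun _ => measurableSet_Icc

/-- The box `c9Box a ℓ` has volume `ℓ³` (for `ℓ < 0` it is empty and `ENNReal.ofReal ℓ = 0`). -/
theorem freeBox_volume (a : V3) (ℓ : ℝ) : volume (c9Box a ℓ) = ENNReal.ofReal ℓ ^ 3 := by
  rw [show c9Box a ℓ = {y : V3 | ∀ i, y i ∈ Icc (a i) (a i + ℓ)} from rfl, freeBox_volume_coordBox fun _ => measurableSet_Icc]
  simp only [Real.volume_Icc, add_sub_cancel_left, Finset.prod_const, Finset.card_univ, Fintype.card_fin]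

/-- The box `c9Box a ℓ` is bounded (it is the `WithLp` image of a product of bounded intervals). -/
theorem freeBox_isBounded (a : V3) (ℓ : ℝ) : Bornology.IsBounded (c9Box a ℓ) := by
  refine ((PiLp.lipschitzWith_toLp 2 (fun _ : Fin 3 => ℝ)).isBounded_image
    (Bornology.IsBounded.pi fun i : Fin 3 => Metric.isBounded_Icc (a i) (a i + ℓ))).subset fun y hy => ?_
  exact ⟨WithLp.ofLp y, fun i _ => hy i, rfl⟩

/-- The inner box `Q(t) = ∏ᵢ [aᵢ + t, aᵢ + ℓ - t]` has volume `(ℓ - 2t)³` (and is empty, of volume `0`, for `2t > ℓ`). -/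
theorem freeBox_volume_layer (a : V3) (ℓ t : ℝ) :
    volume {y : V3 | ∀ i, y i ∈ Icc (a i + t) (a i + ℓ - t)} = ENNReal.ofReal (ℓ - 2 * t) ^ 3 := by
  rw [freeBox_volume_coordBox fun _ => measurableSet_Icc]
  simp only [Real.volume_Icc]
  rw [Finset.prod_congr rfl fun i _ => congrArg ENNReal.ofReal (show a i + ℓ - t - (a i + t) = ℓ - 2 * t by ring),
    Finset.prod_const, Finset.card_univ, Fintype.card_fin]

/-- A ball of radius `r ≤ t` around a point of the inner box `Q(t)` lies in the box. -/
theorem freeBox_ball_subset {a : V3} {ℓ t r : ℝ} {q : V3} (hq : q ∈ {y : V3 | ∀ i, y i ∈ Icc (a i + t) (a i + ℓ - t)})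
    (hr : r ≤ t) : Metric.ball q r ⊆ c9Box a ℓ := by
  intro y hy i
  rw [Metric.mem_ball, dist_eq_norm] at hy
  have hi : |y i - q i| < r := lt_of_le_of_lt (by simpa using PiLp.norm_apply_le (y - q) i) hy
  rw [abs_lt] at hi
  have h1 := (hq i).1
  have h2 := (hq i).2
  constructor <;> linarith

/-- **Volume of the shells**: `|Q(d) \ Q(d+1)| ≤ 8 ℓ²` for `ℓ ≥ 1` (`w³ - (w-2)³ = 6w² - 12w + 8 ≤ 6w² ≤ 6ℓ²` for
`w = ℓ - 2d ≥ 2`, and `|Q(d)| ≤ 8` for `w < 2`). -/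
theorem freeBox_volume_shell_le (a : V3) {ℓ : ℝ} (hℓ : 1 ≤ ℓ) (d : ℕ) :
    volume ({y : V3 | ∀ i, y i ∈ Icc (a i + d) (a i + ℓ - d)} \
      {y : V3 | ∀ i, y i ∈ Icc (a i + (d + 1 : ℕ)) (a i + ℓ - (d + 1 : ℕ))}) ≤ ENNReal.ofReal (8 * ℓ ^ 2) := by
  have hsub : {y : V3 | ∀ i, y i ∈ Icc (a i + (d + 1 : ℕ)) (a i + ℓ - (d + 1 : ℕ))} ⊆
      {y : V3 | ∀ i, y i ∈ Icc (a i + d) (a i + ℓ - d)} := fun y hy i =>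
    ⟨by have h := (hy i).1; push_cast at h; linarith, by have h := (hy i).2; push_cast at h; linarith⟩
  rw [measure_sdiff hsub (freeBox_measurableSet_coordBox fun _ => measurableSet_Icc).nullMeasurableSet
    (by rw [freeBox_volume_layer]; exact ENNReal.pow_ne_top ENNReal.ofReal_ne_top), freeBox_volume_layer, freeBox_volume_layer,
    show ℓ - 2 * ((d + 1 : ℕ) : ℝ) = ℓ - 2 * d - 2 by push_cast; ring]
  set w : ℝ := ℓ - 2 * d with hw
  have hwℓ : w ≤ ℓ := by rw [hw]; linarith [d.cast_nonneg (α := ℝ)]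
  rcases le_or_gt 2 w with h2 | h2
  · rw [← ENNReal.ofReal_pow (by linarith), ← ENNReal.ofReal_pow (by linarith), ← ENNReal.ofReal_sub _ (pow_nonneg (by linarith) 3)]
    exact ENNReal.ofReal_le_ofReal (by nlinarith [mul_self_le_mul_self (show 0 ≤ w by linarith) hwℓ])
  · calc ENNReal.ofReal w ^ 3 - ENNReal.ofReal (w - 2) ^ 3 ≤ ENNReal.ofReal 2 ^ 3 :=
          tsub_le_self.trans (by gcongr)
      _ ≤ ENNReal.ofReal (8 * ℓ ^ 2) := by
          rw [← ENNReal.ofReal_pow zero_le_two]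
          exact ENNReal.ofReal_le_ofReal (by nlinarith)

/-- **Layer-cake bound for a box.** With `Q_d = ∏ᵢ [aᵢ + d, aᵢ + ℓ - d]` (so `Q_0 = c9Box a ℓ`, `Q_d = ∅` for `2d > ℓ`): if
`f ≤ C 4^{-d}` on `Q_d` for every `d`, then `∫_{c9Box a ℓ} f ≤ 16 C ℓ²` (the shells `Q_d \ Q_{d+1}` cover the box, each has
volume `≤ 8 ℓ²`, and `∑_d 4^{-d} ≤ ∑_d 2^{-d} = 2`). -/
theorem freeBox_setLIntegral_le {f : V3 → ℝ≥0∞} {C : ℝ} (hC : 0 ≤ C) (a : V3) {ℓ : ℝ} (hℓ : 1 ≤ ℓ) (Q : ℕ → Set V3)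
    (hQ : ∀ d : ℕ, Q d = {y : V3 | ∀ i, y i ∈ Icc (a i + d) (a i + ℓ - d)})
    (hd : ∀ (d : ℕ) (q : V3), q ∈ Q d → f q ≤ ENNReal.ofReal (C * (1 / 4 : ℝ) ^ d)) :
    ∫⁻ q in c9Box a ℓ, f q ≤ ENNReal.ofReal (16 * C * ℓ ^ 2) := by
  -- the shells cover the box
  have hcover : c9Box a ℓ ⊆ ⋃ d : ℕ, (Q d \ Q (d + 1)) := by
    intro x hx
    have hx' : ∀ i, x i ∈ Icc (a i) (a i + ℓ) := hx
    rw [mem_iUnion]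
    by_contra hne
    push Not at hne
    have hall : ∀ d : ℕ, x ∈ Q d := by
      intro d
      induction d with
      | zero => rw [hQ]; exact fun i => ⟨by simpa using (hx' i).1, by simpa using (hx' i).2⟩
      | succ d ih => have h := hne d; rw [Set.mem_sdiff, not_and, not_not] at h; exact h ih
    have h := hall ⌈ℓ⌉₊
    rw [hQ] at h
    obtain ⟨h1, h2⟩ := h 0
    linarith [Nat.le_ceil ℓ]
  -- each shell contributes `≤ 8 C ℓ² 2^{-d}`
  have hshell : ∀ d : ℕ, ∫⁻ q in Q d \ Q (d + 1), f q ≤ ENNReal.ofReal (8 * C * ℓ ^ 2) * (2⁻¹ : ℝ≥0∞) ^ d := by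
    intro d
    have h4 : (1 / 4 : ℝ) ^ d ≤ (2⁻¹ : ℝ) ^ d := pow_le_pow_left₀ (by norm_num) (by norm_num) d
    calc ∫⁻ q in Q d \ Q (d + 1), f q ≤ ∫⁻ _ in Q d \ Q (d + 1), ENNReal.ofReal (C * (1 / 4 : ℝ) ^ d) :=
          setLIntegral_mono measurable_const fun q hq => hd d q hq.1
      _ ≤ ENNReal.ofReal (C * (1 / 4 : ℝ) ^ d) * ENNReal.ofReal (8 * ℓ ^ 2) := by
          rw [setLIntegral_const, hQ, hQ]
          exact mul_le_mul_right (freeBox_volume_shell_le a hℓ d) _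
      _ ≤ ENNReal.ofReal (8 * C * ℓ ^ 2 * (2⁻¹ : ℝ) ^ d) := by
          rw [← ENNReal.ofReal_mul (by positivity)]
          refine ENNReal.ofReal_le_ofReal ?_
          calc C * (1 / 4 : ℝ) ^ d * (8 * ℓ ^ 2) = 8 * C * ℓ ^ 2 * (1 / 4 : ℝ) ^ d := by ring
            _ ≤ 8 * C * ℓ ^ 2 * (2⁻¹ : ℝ) ^ d := mul_le_mul_of_nonneg_left h4 (by positivity)
      _ = ENNReal.ofReal (8 * C * ℓ ^ 2) * (2⁻¹ : ℝ≥0∞) ^ d := by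
          rw [ENNReal.ofReal_mul (by positivity), ENNReal.ofReal_pow (by positivity), ENNReal.ofReal_inv_of_pos two_pos,
            ENNReal.ofReal_ofNat]
  calc ∫⁻ q in c9Box a ℓ, f q ≤ ∫⁻ q in ⋃ d : ℕ, (Q d \ Q (d + 1)), f q := lintegral_mono_set hcover
    _ ≤ ∑' d : ℕ, ∫⁻ q in Q d \ Q (d + 1), f q := lintegral_iUnion_le _ _
    _ ≤ ∑' d : ℕ, ENNReal.ofReal (8 * C * ℓ ^ 2) * (2⁻¹ : ℝ≥0∞) ^ d := ENNReal.tsum_le_tsum hshell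
    _ = ENNReal.ofReal (16 * C * ℓ ^ 2) := by
        rw [ENNReal.tsum_mul_left, ENNReal.tsum_geometric_two, ← ENNReal.ofReal_ofNat 2, ← ENNReal.ofReal_mul' (by positivity)]
        congr 1
        ring

/-! ## The mean particle number of a free box -/

/-- W5-1 (B1'), registered stub `c9_free_box_mean_count_sub_le`: **the mean particle number of a free box of any real side
`ℓ ≥ 1` and any position is the density of the Gibbs state times `ℓ³`, up to `C ℓ²`** with `C` depending only on
`z, β, u, G`.  (GNZ on both sides reduces this to `z ∫_Λ |γ_Λ(·|∅){no centre in B(q,1)} - G{no centre in B(0,1)}| dq`,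
`Λ = c9Box a ℓ`; the integrand is `≤ 1` on `Q_d` for `d < 3` and `≤ C₀ 4^{-(d-3)}` on `Q_d` for `d ≥ 3`, as `B(q, d) ⊆ Λ` there
(`freeMean_abs_real_vacant_sub_le`); then the layer-cake bound `freeBox_setLIntegral_le`.) -/
theorem c9_free_box_mean_count_sub_le {z β : ℝ} {u : V3} (hz : 0 < z) (hz1 : z ≤ 1 / 64) (hβ : 0 < β)
    {G : Measure (PointConfig (V3 × V3))} (hG : IsHardSphereGibbs 1 z β u G) (hGT : IsTranslationInvariant G) :
    ∃ C : ℝ, ∀ (a : V3) (ℓ : ℝ), 1 ≤ ℓ →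
      |(∫⁻ ω, ((ω.count univ : ℕ∞) : ℝ≥0∞) ∂(gibbsSpecMeasure 1 z β u (c9Box a ℓ) ∅)).toReal - (density G).toReal * ℓ ^ 3| ≤
        C * ℓ ^ 2 := by
  obtain ⟨C₀, hC₀, hcmp⟩ := freeMean_abs_real_vacant_sub_le hz hz1 hβ hG
  refine ⟨z * (16 * (64 * (1 + C₀))), fun a ℓ hℓ => ?_⟩
  haveI : IsProbabilityMeasure G := hG.1
  have hℓ0 : 0 ≤ ℓ := zero_le_one.trans hℓ
  have hΛ : MeasurableSet (c9Box a ℓ) := freeBox_measurableSet a ℓ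
  have hvol := freeBox_volume a ℓ
  haveI : IsFiniteMeasure (gibbsSpecMeasure 1 z β u (c9Box a ℓ) ∅) :=
    ⟨(gibbsSpecMeasure_univ_le_one 1 z β u hΛ ∅).trans_lt ENNReal.one_lt_top⟩
  have hR1 : ∀ q : V3, gibbsSpecMeasure 1 z β u (c9Box a ℓ) ∅
      {X : PointConfig (V3 × V3) | X.count (Metric.ball q 1 ×ˢ (univ : Set V3)) = 0} ≤ 1 := fun q =>
    (measure_mono (subset_univ _)).trans (gibbsSpecMeasure_univ_le_one 1 z β u hΛ ∅)
  -- the pointwise comparison on the inner boxes `Q_d = ∏ᵢ [aᵢ + d, aᵢ + ℓ - d]`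
  have hd : ∀ (d : ℕ) (q : V3), q ∈ {y : V3 | ∀ i, y i ∈ Icc (a i + d) (a i + ℓ - d)} →
      ENNReal.ofReal |(gibbsSpecMeasure 1 z β u (c9Box a ℓ) ∅
          {X : PointConfig (V3 × V3) | X.count (Metric.ball q 1 ×ˢ (univ : Set V3)) = 0}).toReal -
        (G {X : PointConfig (V3 × V3) | X.count (Metric.ball 0 1 ×ˢ (univ : Set V3)) = 0}).toReal| ≤
      ENNReal.ofReal (64 * (1 + C₀) * (1 / 4 : ℝ) ^ d) := by
    intro d q hq
    refine ENNReal.ofReal_le_ofReal ?_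
    rcases lt_or_ge d 3 with hd | hd
    · -- `d < 3`: both probabilities lie in `[0, 1]`, and `64 (1 + C₀) 4^{-d} ≥ 4`
      have hr : (gibbsSpecMeasure 1 z β u (c9Box a ℓ) ∅
          {X : PointConfig (V3 × V3) | X.count (Metric.ball q 1 ×ˢ (univ : Set V3)) = 0}).toReal ≤ 1 :=
        ENNReal.toReal_le_of_le_ofReal zero_le_one (by rw [ENNReal.ofReal_one]; exact hR1 q)
      have hg : (G {X : PointConfig (V3 × V3) | X.count (Metric.ball 0 1 ×ˢ (univ : Set V3)) = 0}).toReal ≤ 1 :=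
        ENNReal.toReal_le_of_le_ofReal zero_le_one (by rw [ENNReal.ofReal_one]; exact prob_le_one)
      have h16 : (1 / 16 : ℝ) ≤ (1 / 4 : ℝ) ^ d := by
        interval_cases d <;> norm_num
      refine (abs_sub_le_of_nonneg_of_le ENNReal.toReal_nonneg hr ENNReal.toReal_nonneg hg).trans ?_
      nlinarith [h16, mul_nonneg hC₀ (pow_nonneg (show (0 : ℝ) ≤ 1 / 4 by norm_num) d)]
    · -- `d ≥ 3`: `B(q, (d-3)+3) ⊆ Λ`
      obtain ⟨k, rfl⟩ : ∃ k, d = k + 3 := ⟨d - 3, by omega⟩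
      have hk := hcmp hΛ (freeBox_isBounded a ℓ) k q (freeBox_ball_subset hq (by push_cast; exact le_rfl))
      refine hk.trans ?_
      rw [pow_add]
      nlinarith [pow_nonneg (show (0 : ℝ) ≤ 1 / 4 by norm_num) k]
  -- the integrated comparison (layer cake), then GNZ on both sides
  have habs := freeMean_abs_toReal_setLIntegral_sub_le (by rw [hvol]; exact ENNReal.pow_ne_top ENNReal.ofReal_ne_top)
    (freeMean_measurable_measure_vacant _ 1) hR1 (measure_ne_top G _) (by positivity)
    (freeBox_setLIntegral_le (by positivity) a hℓ _ (fun d => rfl) hd)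
  rw [hvol, ENNReal.toReal_pow, ENNReal.toReal_ofReal hℓ0] at habs
  rw [freeMean_lintegral_count_univ_eq 1 z β u hΛ, lintegral_count_gibbsSpecMeasure_eq 1 hz.le β u hΛ ∅,
    lintegral_freeVolume_eq 1 hβ u (c9Box a ℓ), density_eq_activity_mul_measure_ball_empty hG hGT hz.le hβ,
    ENNReal.toReal_mul, ENNReal.toReal_mul, ENNReal.toReal_ofReal hz.le]
  have key : ∀ A B : ℝ, |z * A - z * B * ℓ ^ 3| = z * |A - B * ℓ ^ 3| := fun A B => by
    rw [mul_assoc, ← mul_sub, abs_mul, abs_of_pos hz]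
  rw [key]
  linarith [mul_le_mul_of_nonneg_left habs hz.le]

end Summit.AtomisticToContinuum.HydrodynamicLimit.Theorems.KiferCompactification

end
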